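import Summits.Ventures.Crystal3D.Theorems.StickyWulffConstantGenericWallFloorStackLedgerOneSidedDownTilt
import Summits.Ventures.Crystal3D.Theorems.StickyWulffConstantGenericWallFloorAtHalfTilt
import HarnessLib

/-!
# `GenericWallFloor` per pair from the TOP grain's walkers along a slot steep for a TILTED vertical (mirror of
# `…AtHalfTilt`): charge `½κ₂` for every down-slot with `e₃`-component `≤ −13/25` whose rays miss the near lattice
# (crux `GenericWallFloor`, stmt-Ventures-19480, line `WallLedgerG`)

HONEST FRAMING. Venture `Summits/Ventures/Crystal3D` (cell `crystal3d-full`), helper `--supports` the crux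
`GenericWallFloor` of `route-Ventures-StickyWulffConstant`, REGISTERED line `WallLedgerG`, open stub
`stub_twoSlabAdhesion`.  Rung credit only; F-C1 not moved; NOT the crux: the charge is `½κ₂ < 1` in general, and the
certified computations `ExactOnly`(C12-55) [E1] and `StarPairFar` remain inputs BY NAME.

* `exists_tilt_vertical_down` — every unit `v` with `⟪v, e₃⟫ ≤ −13/25` is steep for some unit `z` with `‖z + e₃‖ ≤ 1/4`;
* `genericWallFloorAtCharge_oneSidedDown_tilt_of_far` / `…_chainDown_tilt_of_far` / `…_wordDown_tilt_of_far` — the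
  grain-2 analogues of `…AtHalfTilt` on the tilted ledger `twoSlabAdhesion_stackLedger_oneSidedDown_tilt`;
* **`genericWallFloorAtCharge_wordDown_of_inner_le`** — chain pair presented over grain 2 (`A₁·Λ₀ = (wordFrame A₂ κ)·Λ₀`,
  `|κ| ≥ 2`) and ANY slot `u₂` of grain 2 IN its first mirror plane with `⟪A₂u₂, e₃⟫ ≤ −13/25`:
  `GenericWallFloorAtCharge (√2|⟪A₂u₂, e₃⟫|/2)` (`≥ 0.367`), modulo `ExactOnly`(C12-55) and `StarPairFar`.

Together with `…AtHalfTilt` this covers, by the seat census (`calc/sigma9_census.py`, 3000 Haar `Σ9` pairs), `99.4 %` of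
the mutual-arrival class and `99.8 %` of the ray-aligned residual with a residual-free floor `c₀ ≥ 0.367` (grain 1 alone:
`75 %` / grain 2 alone: `69 %` of the mutual-arrival class).
WHAT THIS IS NOT: not `c₀ = 1` on the core; F-C1 not moved.
-/

noncomputable section

namespace Summit.Ventures.Crystal3D.Theorems

open Summit.Ventures.Crystal3D Finset
open Literature.MathematicalPhysics.StatisticalMechanics (fccStacking barlowStacking IsHaggSeq)
open scoped InnerProductSpace

/-- **A tilted vertical for the top grain.**  Every unit vector `v` with `⟪v, e₃⟫ ≤ −13/25` is steep
(`⟪v, z⟫ ≥ √2/2`) for some unit `z` with `‖z + e₃‖ ≤ 1/4`. -/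
theorem exists_tilt_vertical_down {v : EuclideanSpace ℝ (Fin 3)} (hv : ‖v‖ = 1)
    (hs : ⟪v, EuclideanSpace.single (2 : Fin 3) (1 : ℝ)⟫_ℝ ≤ -(13 / 25 : ℝ)) :
    ∃ z : EuclideanSpace ℝ (Fin 3), ‖z‖ = 1 ∧ ‖z + EuclideanSpace.single (2 : Fin 3) (1 : ℝ)‖ ≤ 1 / 4 ∧
      Real.sqrt 2 / 2 ≤ ⟪v, z⟫_ℝ := by
  have hv' : ‖-v‖ = 1 := by rw [norm_neg, hv]
  have hs' : (13 / 25 : ℝ) ≤ ⟪-v, EuclideanSpace.single (2 : Fin 3) (1 : ℝ)⟫_ℝ := by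
    rw [inner_neg_left]; linarith
  obtain ⟨z, hz, hze, hsteep⟩ := exists_tilt_vertical hv' hs'
  refine ⟨-z, by rw [norm_neg, hz], ?_, by rwa [inner_neg_right, ← inner_neg_left]⟩
  rw [show -z + EuclideanSpace.single (2 : Fin 3) (1 : ℝ) = -(z - EuclideanSpace.single (2 : Fin 3) (1 : ℝ)) by abel,
    norm_neg]
  exact hze

/-! ### Grain 2 alone, tilted vertical -/

open scoped Classical in
/-- **`GenericWallFloor` per pair at charge `½κ₂` from grain 2 alone, tilted vertical**, modulo `ExactOnly`(C12-55)
and `StarPairFar`: unit `z` with `‖z + e₃‖ ≤ 1/4`, slot `u₂` steep for `z`, every frame of every sound well-formed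
`z`-stack over `(A₂, u₂, 0)` lies in `M₂`, and no frame of `M₂` has `A₁`'s lattice. -/
theorem genericWallFloorAtCharge_oneSidedDown_tilt_of_far
    {s₀ : EuclideanSpace ℝ (Fin 3)} (hs₀ : s₀ ∈ fccSlots)
    (hcert : ExactOnly 0 (fccSlots.filter fun w => 0 < ⟪w, s₀⟫_ℝ)) (hfar : StarPairFar)
    (A₁ : EuclideanSpace ℝ (Fin 3) ≃ₗᵢ[ℝ] EuclideanSpace ℝ (Fin 3)) (t₁ : EuclideanSpace ℝ (Fin 3))
    (A₂ : EuclideanSpace ℝ (Fin 3) ≃ₗᵢ[ℝ] EuclideanSpace ℝ (Fin 3)) (t₂ : EuclideanSpace ℝ (Fin 3))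
    {z : EuclideanSpace ℝ (Fin 3)} (hz : ‖z‖ = 1) (hze : ‖z + EuclideanSpace.single (2 : Fin 3) (1 : ℝ)‖ ≤ 1 / 4)
    {u₂ : EuclideanSpace ℝ (Fin 3)} (hu₂ : u₂ ∈ fccSlots) (hsteep₂ : Real.sqrt 2 / 2 ≤ ⟪A₂ u₂, z⟫_ℝ)
    (M₂ : Set (EuclideanSpace ℝ (Fin 3) ≃ₗᵢ[ℝ] EuclideanSpace ℝ (Fin 3)))
    (hM₂ : ∀ stk : List WalkEntry, StackSound z stk → StackWF z stk → stk.getLast? = some ⟨A₂, u₂, 0⟩ →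
      ∀ e ∈ stk, e.frame ∈ M₂)
    (hmiss : ∀ F ∈ M₂, F '' fccStacking 1 (Real.sqrt (2 / 3)) ≠ A₁ '' fccStacking 1 (Real.sqrt (2 / 3))) :
    GenericWallFloorAtCharge (Real.sqrt 2 * |⟪A₂ u₂, EuclideanSpace.single (2 : Fin 3) (1 : ℝ)⟫_ℝ| / 2) A₁ t₁ A₂ t₂ :=
  genericWallFloorAtCharge_of_ledger _ A₁ t₁ A₂ t₂
    (twoSlabAdhesion_stackLedger_oneSidedDown_tilt hs₀ hcert (doubleStarCoaxialAt_of_starPairFar hfar)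
      (capPairCoaxial_of_starPairFar hfar) A₁ t₁ A₂ t₂ hz hze hu₂ hsteep₂ M₂ hM₂ hmiss)

open scoped Classical in
/-- **Charge `½κ₂` from grain 2 over the FORCED RAYS of the tilted walk** (`chainFrames z A₂ u₂` misses `A₁`'s
lattice). -/
theorem genericWallFloorAtCharge_chainDown_tilt_of_far
    {s₀ : EuclideanSpace ℝ (Fin 3)} (hs₀ : s₀ ∈ fccSlots)
    (hcert : ExactOnly 0 (fccSlots.filter fun w => 0 < ⟪w, s₀⟫_ℝ)) (hfar : StarPairFar)
    (A₁ : EuclideanSpace ℝ (Fin 3) ≃ₗᵢ[ℝ] EuclideanSpace ℝ (Fin 3)) (t₁ : EuclideanSpace ℝ (Fin 3))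
    (A₂ : EuclideanSpace ℝ (Fin 3) ≃ₗᵢ[ℝ] EuclideanSpace ℝ (Fin 3)) (t₂ : EuclideanSpace ℝ (Fin 3))
    {z : EuclideanSpace ℝ (Fin 3)} (hz : ‖z‖ = 1) (hze : ‖z + EuclideanSpace.single (2 : Fin 3) (1 : ℝ)‖ ≤ 1 / 4)
    {u₂ : EuclideanSpace ℝ (Fin 3)} (hu₂ : u₂ ∈ fccSlots) (hsteep₂ : Real.sqrt 2 / 2 ≤ ⟪A₂ u₂, z⟫_ℝ)
    (hmiss : ∀ F ∈ chainFrames z A₂ u₂,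
      F '' fccStacking 1 (Real.sqrt (2 / 3)) ≠ A₁ '' fccStacking 1 (Real.sqrt (2 / 3))) :
    GenericWallFloorAtCharge (Real.sqrt 2 * |⟪A₂ u₂, EuclideanSpace.single (2 : Fin 3) (1 : ℝ)⟫_ℝ| / 2) A₁ t₁ A₂ t₂ :=
  genericWallFloorAtCharge_oneSidedDown_tilt_of_far hs₀ hcert hfar A₁ t₁ A₂ t₂ hz hze hu₂ hsteep₂ _
    (fun _ hS hW hlast => frame_mem_chainFrames_of_stack hS hW hlast) hmiss

open scoped Classical in
/-- **Charge `½κ₂` from grain 2 under the one-sided WORD CRITERION, tilted vertical**: `A₁·Λ₀ = (wordFrame A₂ κ)·Λ₀`,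
`|κ| ≥ 2`, unit `z` with `‖z + e₃‖ ≤ 1/4`, slot `u₂` steep for `z` IN grain 2's first mirror plane (`⟪u₂, μ⟫ = 0` for
the last letter `μ`). -/
theorem genericWallFloorAtCharge_wordDown_tilt_of_far
    {s₀ : EuclideanSpace ℝ (Fin 3)} (hs₀ : s₀ ∈ fccSlots)
    (hcert : ExactOnly 0 (fccSlots.filter fun w => 0 < ⟪w, s₀⟫_ℝ)) (hfar : StarPairFar)
    (A₁ : EuclideanSpace ℝ (Fin 3) ≃ₗᵢ[ℝ] EuclideanSpace ℝ (Fin 3)) (t₁ : EuclideanSpace ℝ (Fin 3))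
    (A₂ : EuclideanSpace ℝ (Fin 3) ≃ₗᵢ[ℝ] EuclideanSpace ℝ (Fin 3)) (t₂ : EuclideanSpace ℝ (Fin 3))
    {z : EuclideanSpace ℝ (Fin 3)} (hz : ‖z‖ = 1) (hze : ‖z + EuclideanSpace.single (2 : Fin 3) (1 : ℝ)‖ ≤ 1 / 4)
    {u₂ : EuclideanSpace ℝ (Fin 3)} (hu₂ : u₂ ∈ fccSlots) (hsteep₂ : Real.sqrt 2 / 2 ≤ ⟪A₂ u₂, z⟫_ℝ)
    (κ : List (EuclideanSpace ℝ (Fin 3)))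
    (hκl : ∀ μ ∈ κ, ‖μ‖ = 1 ∧
      ∀ w ∈ fccSlots, ⟪w, μ⟫_ℝ = 0 ∨ ⟪w, μ⟫_ℝ = Real.sqrt (2 / 3) ∨ ⟪w, μ⟫_ℝ = -Real.sqrt (2 / 3))
    (hκc : List.IsChain (fun μ μ' => ⟪μ, μ'⟫_ℝ = 1 / 3 ∨ ⟪μ, μ'⟫_ℝ = -1 / 3) κ) (hκ2 : 2 ≤ κ.length)
    (hA₁ : A₁ '' fccStacking 1 (Real.sqrt (2 / 3)) = (wordFrame A₂ κ) '' fccStacking 1 (Real.sqrt (2 / 3)))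
    (hfirst : ∀ μ, κ.getLast? = some μ → ⟪u₂, μ⟫_ℝ = 0) :
    GenericWallFloorAtCharge (Real.sqrt 2 * |⟪A₂ u₂, EuclideanSpace.single (2 : Fin 3) (1 : ℝ)⟫_ℝ| / 2) A₁ t₁ A₂ t₂ :=
  genericWallFloorAtCharge_oneSidedDown_tilt_of_far hs₀ hcert hfar A₁ t₁ A₂ t₂ hz hze hu₂ hsteep₂
    {F | ∃ stk : List WalkEntry, StackSound z stk ∧ StackWF z stk ∧ stk.getLast? = some ⟨A₂, u₂, 0⟩ ∧
      ∃ e ∈ stk, e.frame = F}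
    (fun stk hS hW hlast e he => ⟨stk, hS, hW, hlast, e, he, rfl⟩)
    (fun _ ⟨_, hS, hW, hl, _, he, hF⟩ => by rw [← hF]; exact image_ne_of_word κ hκl hκc hκ2 hA₁ hfirst hS hW hl he)

open scoped Classical in
/-- **Charge `½κ₂ = (√2/2)|⟪A₂u₂, e₃⟫|` from grain 2 under the word criterion for EVERY in-plane down-slot of
`e₃`-component `≤ −13/25`** (vertical chosen by `exists_tilt_vertical_down`): `A₁·Λ₀ = (wordFrame A₂ κ)·Λ₀`, `|κ| ≥ 2`,
slot `u₂` IN grain 2's first mirror plane with `⟪A₂u₂, e₃⟫ ≤ −13/25`; modulo `ExactOnly`(C12-55) and `StarPairFar`. -/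
theorem genericWallFloorAtCharge_wordDown_of_inner_le
    {s₀ : EuclideanSpace ℝ (Fin 3)} (hs₀ : s₀ ∈ fccSlots)
    (hcert : ExactOnly 0 (fccSlots.filter fun w => 0 < ⟪w, s₀⟫_ℝ)) (hfar : StarPairFar)
    (A₁ : EuclideanSpace ℝ (Fin 3) ≃ₗᵢ[ℝ] EuclideanSpace ℝ (Fin 3)) (t₁ : EuclideanSpace ℝ (Fin 3))
    (A₂ : EuclideanSpace ℝ (Fin 3) ≃ₗᵢ[ℝ] EuclideanSpace ℝ (Fin 3)) (t₂ : EuclideanSpace ℝ (Fin 3))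
    {u₂ : EuclideanSpace ℝ (Fin 3)} (hu₂ : u₂ ∈ fccSlots)
    (hdown : ⟪A₂ u₂, EuclideanSpace.single (2 : Fin 3) (1 : ℝ)⟫_ℝ ≤ -(13 / 25 : ℝ))
    (κ : List (EuclideanSpace ℝ (Fin 3)))
    (hκl : ∀ μ ∈ κ, ‖μ‖ = 1 ∧
      ∀ w ∈ fccSlots, ⟪w, μ⟫_ℝ = 0 ∨ ⟪w, μ⟫_ℝ = Real.sqrt (2 / 3) ∨ ⟪w, μ⟫_ℝ = -Real.sqrt (2 / 3))
    (hκc : List.IsChain (fun μ μ' => ⟪μ, μ'⟫_ℝ = 1 / 3 ∨ ⟪μ, μ'⟫_ℝ = -1 / 3) κ) (hκ2 : 2 ≤ κ.length)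
    (hA₁ : A₁ '' fccStacking 1 (Real.sqrt (2 / 3)) = (wordFrame A₂ κ) '' fccStacking 1 (Real.sqrt (2 / 3)))
    (hfirst : ∀ μ, κ.getLast? = some μ → ⟪u₂, μ⟫_ℝ = 0) :
    GenericWallFloorAtCharge (Real.sqrt 2 * |⟪A₂ u₂, EuclideanSpace.single (2 : Fin 3) (1 : ℝ)⟫_ℝ| / 2) A₁ t₁ A₂ t₂ := by
  obtain ⟨z, hz, hze, hsteep⟩ := exists_tilt_vertical_down
    (by rw [LinearIsometryEquiv.norm_map, norm_eq_one_of_mem_fccSlots hu₂]) hdown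
  exact genericWallFloorAtCharge_wordDown_tilt_of_far hs₀ hcert hfar A₁ t₁ A₂ t₂ hz hze hu₂ hsteep κ hκl hκc hκ2 hA₁ hfirst

/-- The charge of `genericWallFloorAtCharge_wordDown_of_inner_le` is at least `11/30 > 0.366`. -/
theorem charge_of_inner_le_lower {c : ℝ} (hc : c ≤ -(13 / 25 : ℝ)) : (11 / 30 : ℝ) ≤ Real.sqrt 2 * |c| / 2 := by
  rw [abs_of_nonpos (by linarith)]
  exact charge_of_inner_ge_lower (by linarith)

end Summit.Ventures.Crystal3D.Theorems

end
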